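import Literature.Computability.AlgebraicComplexity.MoreAsymmetricCompatCount
import Literature.Computability.AlgebraicComplexity.GlobalStageParameters
import HarnessLib

/-!
# Choosing the hashing parameters of the more asymmetric global stage: the modulus `M` (Bertrand),
the Salem–Spencer set `B` (Behrend), and the one-region Prop. 5.1 with all requirements discharged
(Alman–Duan–Vassilevska Williams–Xu–Xu–Zhou 2025, §5.2 eq. (M₀) and §5.5 eq. (M₀ final)) — proved

Topic `Literature/Computability/AlgebraicComplexity`.  §5.2/§5.5 of Alman–Duan–Vassilevska Williams–Xu–
Xu–Zhou, *More asymmetry yields faster matrix multiplication* (SODA 2025, arXiv:2404.16349) choose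
"`M ∈ [M₀, 2M₀]` a prime number (its existence is guaranteed by Bertrand's postulate)", "`B` the
Salem–Spencer subset of `ℤ_M` of size `M^{1−o(1)}` from Theorem 3.7", and finally
"`M₀ = max{8 · numtriple/numxblock, (numalpha · p_compY/numyblock) · 80N, (numalpha · p_compZ/numzblock) · 80N}`".
This file PROVES, for well-formed (`MoreAsym.WellFormed`) and symmetric data `D` of one region (with a
triple `T₀ ∈ 𝒯α`, a typical `Y`-pair `pY` and a typical `Z`-pair `pZ`, so that the common values
`M_Y = usefulYCount`, `M_Z = usefulZCount`, `V_Y = |compatTriplesY pY|`, `V_Z = |compatTriples pZ|` of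
`MoreAsymmetricCompatCount.lean` / `GlobalStageCompatCount.lean` make sense), that such parameters EXIST
and meet every counting requirement of the exact one-region Prop. 5.1 (`advxxz2025_prop51_region`) —
the twin of `GlobalStageParameters.lean`:

* `usefulYCount_eq_of_mem` — `M_Y(T)` does not depend on `T ∈ 𝒯α` (symmetry);
* `MoreAsym.modulusBound` — `M₀ = max{8|𝒯|/|X-blocks| + 1, 160 N V_Y, 160 N V_Z, 2c + 2}` (the printed
  `M₀` with the constant of the hole requirements adapted to the exact form `10 U_W ≤ (h_W+1) M`,
  `h_W = ⌊M_W / 8N⌋`, `U_W ≤ M_W V_W`, `W = Y, Z`; the last entry only records `M > 2c`, `M ≠ 2`);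
* `advxxz2025_prop51_region_parameters` — **there are a prime `M` with `M₀ < M ≤ 2M₀` (Bertrand) and a
  set `B ⊆ ℤ/M` without non-trivial 3-term progressions, `|B| ≥ (M/2) e^{-4√(log M)}` (Behrend,
  `advxxz2025_thm37`), such that `(CW_q^{⊗c})^{⊗n} ≥ ⟨⌊|B| · |𝒯α| / (2M²r)⌋⟩ ⊗ 𝒯*_{T₀}`** for every
  `r ≥ 8^{3⌊log_{2N} 3^N⌋+3}` — all requirements (`M` odd prime `> 2c`, cleanup in `X`, `Y`-holes,
  `Z`-holes, hole budgets) discharged from the choice of `M₀`.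

Everything is proved; one definition (`MoreAsym.modulusBound`); no named facts.  Turning `|𝒯α|`, `M₀`,
`|B|`, `r` into the exponent `min{H(α_X) − P_α, H(β̄_Y) − η_Y, H(β̄_Z) − λ_Z}` (entropies) is not part of
this file.

## References

* J. Alman, R. Duan, V. Vassilevska Williams, Y. Xu, Z. Xu, R. Zhou, *More asymmetry yields faster
  matrix multiplication*, SODA 2025, arXiv:2404.16349 (held: `paper:arxiv-2404.16349`, chunks p0016,
  p0020): §5.2 (choice of `M`, `B`, eq. (M₀)), §5.5 (eq. (M₀ final)), Thm. 3.7.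
  [AlmanDuanVassilevskaWilliamsXuXuZhou2025]
* V. Vassilevska Williams, Y. Xu, Z. Xu, R. Zhou, *New bounds for matrix multiplication: from alpha
  to omega*, SODA 2024, arXiv:2307.07970, §5.2 and §5.6 (the original choice of `M₀`).
  [VassilevskaWilliamsXuXuZhou2024]
-/

noncomputable section

open scoped BigOperators
open Finset

namespace Literature.Computability.AlgebraicComplexity

open Literature.Barriers.MatrixMultiplication (bigCwTensor)

namespace GlobalStageData

open scoped Classical

universe u

variable {c n M : ℕ} {D : GlobalStageData c n M}

/-- `M_Y` is `S_n`-invariant. [cite: AlmanDuanVassilevskaWilliamsXuXuZhou2025, Claim 5.17 (proof, "by symmetry")] -/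
theorem usefulYCount_permT (σ : Equiv.Perm (Fin n))
    (T : (Fin n → Fin (2 * c + 1)) × (Fin n → Fin (2 * c + 1)) × (Fin n → Fin (2 * c + 1))) :
    D.usefulYCount (permT σ T) = D.usefulYCount T := by
  unfold usefulYCount
  symm
  refine Finset.card_equiv (Equiv.arrowCongr σ.symm (Equiv.refl _)) fun Jh => ?_
  simp only [mem_filter, mem_univ, true_and]
  have e : (Equiv.arrowCongr σ.symm (Equiv.refl (Fin c → Fin 3))) Jh = Jh ∘ σ := by
    funext t; simp [Equiv.arrowCongr_apply]
  rw [e]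
  have hu : D.UsefulY (permT σ T) (Jh ∘ σ) ↔ D.UsefulY T Jh :=
    isUsefulFor_comp_iff D.γY (seqVal T.1) (seqVal T.2.1) (seqVal T.2.2) Jh σ
  rw [hu]
  constructor
  · rintro ⟨hb, hc⟩
    exact ⟨by rw [← show (blockOfSeq Jh) ∘ σ = blockOfSeq (Jh ∘ σ) from rfl, hb], hc⟩
  · rintro ⟨hb, hc⟩
    refine ⟨?_, hc⟩
    have hb' : (blockOfSeq Jh) ∘ σ = T.2.1 ∘ σ := hb
    exact comp_perm_injective σ hb'

/-- **`M_Y(T)` does not depend on the triple of `𝒯α`.** [cite: AlmanDuanVassilevskaWilliamsXuXuZhou2025, Claim 5.17 (proof)] -/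
theorem usefulYCount_eq_of_mem (hS : D.Symmetric)
    {T T' : (Fin n → Fin (2 * c + 1)) × (Fin n → Fin (2 * c + 1)) × (Fin n → Fin (2 * c + 1))}
    (hT : T ∈ D.𝒯α) (hT' : T' ∈ D.𝒯α) : D.usefulYCount T = D.usefulYCount T' := by
  obtain ⟨σ, hσ⟩ := hS.trans T hT T' hT'
  rw [← hσ, usefulYCount_permT]

namespace MoreAsym

variable (D)

/-- **The bound `M₀` on the modulus** (eq. (M₀ final), with the constants of the exact form):
`max{8|𝒯|/|typeClass μX| + 1, 160 · N · V_Y, 160 · N · V_Z, 2c + 2}`, `N = cn`, `V_Y = |compatTriplesY pY|`,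
`V_Z = |compatTriples pZ|`. [cite: AlmanDuanVassilevskaWilliamsXuXuZhou2025, §5.5 eq. (M₀ final) ("M₀ = max{8·numtriple/numxblock, (numalpha·p_compY/numyblock)·80N, (numalpha·p_compZ/numzblock)·80N}")] -/
def modulusBound (pY pZ : (Fin n → Fin (2 * c + 1)) × (Fin n → Fin c → Fin 3)) : ℕ :=
  max (max (8 * D.tripleSet.card / (typeClass n D.μX).card + 1) (160 * (c * n) * (D.compatTriplesY pY.1 pY.2).card))
    (max (160 * (c * n) * (D.compatTriples pZ.1 pZ.2).card) (2 * c + 2))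

variable {D}

/-- **ADVXXZ Prop. 5.1, one region, with the hashing parameters chosen.**  For well-formed symmetric data
`D` of one region (`c, n ≥ 1`), a triple `T₀ ∈ 𝒯α`, a typical `Y`-pair `pY` and a typical `Z`-pair `pZ`:
there are a prime `M` with `M₀ < M ≤ 2M₀` (`M₀ = MoreAsym.modulusBound`, Bertrand's postulate) and
`B ⊆ ℤ/M` free of non-trivial 3-term progressions with `|B| ≥ (M/2) e^{-4√(log M)}` (Behrend) such that,
for every `r ≥ 8^{3⌊log_{2N} 3^N⌋+3}`, `(CW_q^{⊗c})^{⊗n} ≥ ⟨⌊|B| |𝒯α| / (2M²r)⌋⟩ ⊗ 𝒯*_{T₀}` — the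
requirements of `advxxz2025_prop51_region` (cleanup `8|𝒯| ≤ M|X-blocks|`; holes `10U_W ≤ (h_W+1)M` with
`h_W = ⌊M_W/8N⌋` via `U_W ≤ M_W V_W`; hole budgets `8N h_W ≤ M_W`, `W = Y, Z`) all following from `M > M₀`.
[cite: AlmanDuanVassilevskaWilliamsXuXuZhou2025, Prop. 5.1, §5.2 and §5.5] -/
theorem advxxz2025_prop51_region_parameters {M₁ : ℕ} (D : GlobalStageData c n M₁) (hD : WellFormed D)
    (hS : D.Symmetric) (R : Type u) [CommSemiring R] (q : ℕ) (hc : 0 < c) (hn : 0 < n)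
    {T₀ : (Fin n → Fin (2 * c + 1)) × (Fin n → Fin (2 * c + 1)) × (Fin n → Fin (2 * c + 1))} (hT₀ : T₀ ∈ D.𝒯α)
    {pY : (Fin n → Fin (2 * c + 1)) × (Fin n → Fin c → Fin 3)} (hpY : pY ∈ D.typicalPairsY)
    {pZ : (Fin n → Fin (2 * c + 1)) × (Fin n → Fin c → Fin 3)} (hpZ : pZ ∈ D.typicalPairs) :
    ∃ (M : ℕ) (B : Finset (ZMod M)), M.Prime ∧ modulusBound D pY pZ < M ∧ M ≤ 2 * modulusBound D pY pZ ∧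
      ThreeAPFree (B : Set (ZMod M)) ∧ (M : ℝ) / 2 * Real.exp (-4 * Real.sqrt (Real.log M)) ≤ B.card ∧
      ∀ {r : ℕ}, 8 ^ (3 * Nat.log (2 * (c * n)) (3 ^ (c * n)) + 3) ≤ r →
        TensorRestrictsTo (kroneckerPow (kroneckerPow (bigCwTensor R q) c) n)
          (kroneckerTensor (unitTensor R (B.card * D.𝒯α.card / (2 * M ^ 2 * r))) (D.starTensor R q T₀)) := by
  set M₀ := modulusBound D pY pZ with hM₀
  have hM₀pos : M₀ ≠ 0 := by
    have : 2 * c + 2 ≤ M₀ := le_max_of_le_right (le_max_right _ _)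
    omega
  -- Bertrand: a prime `M₀ < M ≤ 2 M₀`
  obtain ⟨M, hMprime, hM₀M, hM2M₀⟩ := Nat.exists_prime_lt_and_le_two_mul M₀ hM₀pos
  -- Behrend: a Salem–Spencer set modulo `M` (Thm. 3.7)
  haveI : NeZero M := ⟨hMprime.ne_zero⟩
  obtain ⟨B, hBcard, hBfree'⟩ := advxxz2025_thm37 M
  have hBfree : ThreeAPFree (B : Set (ZMod M)) := threeAPFree_of_pairwise hBfree'
  refine ⟨M, B, hMprime, hM₀M, hM2M₀, hBfree, hBcard, fun {r} hr => ?_⟩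
  -- the data with the chosen set `B`
  haveI : Fact M.Prime := ⟨hMprime⟩
  let D' : GlobalStageData c n M := { D with B := B }
  have hD'₀ : D'.WellFormed := ⟨hD.subset, hD.alphaConsistent, hD.revX, hD.revY⟩
  have hD' : WellFormed D' := ⟨hD'₀, hD.revXY⟩
  -- the requirements
  have h2c2 : 2 * c + 2 ≤ M₀ := le_max_of_le_right (le_max_right _ _)
  have hM2 : M ≠ 2 := by omega
  have hcM : 2 * c < M := by omega
  have hT₀𝒯 : T₀ ∈ D.tripleSet := hD.subset hT₀
  have hXne : 0 < (typeClass n D.μX).card :=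
    card_pos.2 ⟨T₀.1, mem_typeClass.2 (mem_typedSupport.1 hT₀𝒯).1⟩
  have h8X : 8 * D'.tripleSet.card ≤ M * (typeClass n D'.μX).card := by
    show 8 * D.tripleSet.card ≤ M * (typeClass n D.μX).card
    have h1 : 8 * D.tripleSet.card / (typeClass n D.μX).card + 1 ≤ M₀ := le_max_of_le_left (le_max_left _ _)
    have h2 : 8 * D.tripleSet.card < (8 * D.tripleSet.card / (typeClass n D.μX).card + 1) * (typeClass n D.μX).card :=
      Nat.lt_div_mul_add hXne |>.trans_le (by rw [Nat.add_mul, one_mul])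
    calc 8 * D.tripleSet.card ≤ (8 * D.tripleSet.card / (typeClass n D.μX).card + 1) * (typeClass n D.μX).card := h2.le
      _ ≤ M * (typeClass n D.μX).card := Nat.mul_le_mul_right _ (by omega)
  -- the hole requirements with `h_W = ⌊M_W / 8N⌋`
  set ZY := D.usefulYCount T₀ with hZY
  set ZZ := D.usefulZCount T₀ with hZZ
  set VY := (D.compatTriplesY pY.1 pY.2).card with hVY
  set VZ := (D.compatTriples pZ.1 pZ.2).card with hVZ
  set hY := ZY / (8 * (c * n)) with hhY
  set hZ := ZZ / (8 * (c * n)) with hhZ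
  have hN : 0 < 8 * (c * n) := by positivity
  have hZYlt : ZY < (hY + 1) * (8 * (c * n)) := by
    rw [hhY]; exact Nat.lt_div_mul_add hN |>.trans_le (by rw [Nat.add_mul, one_mul])
  have hZZlt : ZZ < (hZ + 1) * (8 * (c * n)) := by
    rw [hhZ]; exact Nat.lt_div_mul_add hN |>.trans_le (by rw [Nat.add_mul, one_mul])
  have hMVY : 160 * (c * n) * VY ≤ M := (le_max_of_le_left (le_max_right _ _) : 160 * (c * n) * VY ≤ M₀).trans hM₀M.le
  have hMVZ : 160 * (c * n) * VZ ≤ M := (le_max_of_le_right (le_max_left _ _) : 160 * (c * n) * VZ ≤ M₀).trans hM₀M.le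
  have hS' : D'.Symmetric := ⟨hS.perm_mem, hS.trans⟩
  have hn' : M ^ n = M * M ^ (n - 1) := by
    rw [← pow_succ']; congr 1; omega
  have hUY : ∀ T ∈ D'.𝒯α, 10 * ((D'.holePairsY T).card * M ^ (n - 1)) ≤ (hY + 1) * M ^ n := by
    intro T hT
    have hTα : T ∈ D.𝒯α := hT
    have hUle : (D'.holePairsY T).card ≤ D'.usefulYCount T * (D'.compatTriplesY pY.1 pY.2).card :=
      card_holePairsY_le hD'₀ hS' hT hpY
    have hZT : D'.usefulYCount T = ZY := usefulYCount_eq_of_mem hS hTα hT₀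
    rw [hZT] at hUle
    have hV' : (D'.compatTriplesY pY.1 pY.2).card = VY := rfl
    rw [hV'] at hUle
    rw [hn']
    have key : 10 * (ZY * VY) ≤ (hY + 1) * M := by
      calc 10 * (ZY * VY) ≤ 10 * ((hY + 1) * (8 * (c * n)) * VY) :=
            Nat.mul_le_mul_left _ (Nat.mul_le_mul_right _ hZYlt.le)
        _ = (hY + 1) * (80 * (c * n) * VY) := by ring
        _ ≤ (hY + 1) * (160 * (c * n) * VY) :=
            Nat.mul_le_mul_left _ (Nat.mul_le_mul_right _ (Nat.mul_le_mul_right _ (by norm_num)))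
        _ ≤ (hY + 1) * M := Nat.mul_le_mul_left _ hMVY
    calc 10 * ((D'.holePairsY T).card * M ^ (n - 1)) ≤ 10 * (ZY * VY * M ^ (n - 1)) :=
          Nat.mul_le_mul_left _ (Nat.mul_le_mul_right _ hUle)
      _ = 10 * (ZY * VY) * M ^ (n - 1) := by ring
      _ ≤ (hY + 1) * M * M ^ (n - 1) := Nat.mul_le_mul_right _ key
      _ = (hY + 1) * (M * M ^ (n - 1)) := by ring
  have hUZ : ∀ T ∈ D'.𝒯α, 10 * ((D'.holePairs T).card * M ^ (n - 1)) ≤ (hZ + 1) * M ^ n := by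
    intro T hT
    have hTα : T ∈ D.𝒯α := hT
    have hUle : (D'.holePairs T).card ≤ D'.usefulZCount T * (D'.compatTriples pZ.1 pZ.2).card :=
      card_holePairs_le hD'₀ hS' hT hpZ
    have hZT : D'.usefulZCount T = ZZ := usefulZCount_eq_of_mem hS hTα hT₀
    rw [hZT] at hUle
    have hV' : (D'.compatTriples pZ.1 pZ.2).card = VZ := rfl
    rw [hV'] at hUle
    rw [hn']
    have key : 10 * (ZZ * VZ) ≤ (hZ + 1) * M := by
      calc 10 * (ZZ * VZ) ≤ 10 * ((hZ + 1) * (8 * (c * n)) * VZ) :=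
            Nat.mul_le_mul_left _ (Nat.mul_le_mul_right _ hZZlt.le)
        _ = (hZ + 1) * (80 * (c * n) * VZ) := by ring
        _ ≤ (hZ + 1) * (160 * (c * n) * VZ) :=
            Nat.mul_le_mul_left _ (Nat.mul_le_mul_right _ (Nat.mul_le_mul_right _ (by norm_num)))
        _ ≤ (hZ + 1) * M := Nat.mul_le_mul_left _ hMVZ
    calc 10 * ((D'.holePairs T).card * M ^ (n - 1)) ≤ 10 * (ZZ * VZ * M ^ (n - 1)) :=
          Nat.mul_le_mul_left _ (Nat.mul_le_mul_right _ hUle)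
      _ = 10 * (ZZ * VZ) * M ^ (n - 1) := by ring
      _ ≤ (hZ + 1) * M * M ^ (n - 1) := Nat.mul_le_mul_right _ key
      _ = (hZ + 1) * (M * M ^ (n - 1)) := by ring
  have hhY' : ∀ T ∈ D'.𝒯α, 8 * (c * n) * hY ≤ D'.usefulYCount T := by
    intro T hT
    have hTα : T ∈ D.𝒯α := hT
    rw [show D'.usefulYCount T = ZY from usefulYCount_eq_of_mem hS hTα hT₀, hhY, mul_comm]
    exact Nat.div_mul_le_self ZY _
  have hhZ' : ∀ T ∈ D'.𝒯α, 8 * (c * n) * hZ ≤ D'.usefulZCount T := by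
    intro T hT
    have hTα : T ∈ D.𝒯α := hT
    rw [show D'.usefulZCount T = ZZ from usefulZCount_eq_of_mem hS hTα hT₀, hhZ, mul_comm]
    exact Nat.div_mul_le_self ZZ _
  have hT₀' : T₀ ∈ D'.𝒯α := hT₀
  exact advxxz2025_prop51_region hD' R q hM2 hcM hc hn hBfree h8X hUY hUZ hhY' hhZ' hr hT₀'

end MoreAsym

end GlobalStageData

end Literature.Computability.AlgebraicComplexity
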